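import Summits.BirchSwinnertonDyer.BirchSwinnertonDyer.Theses.ResidualThetaTransportAtTwo
import Summits.BirchSwinnertonDyer.BirchSwinnertonDyer.Theorems.ResidualThetaTransportAtTwoHeckeThetaPartnerAdicAtTwo
import HarnessLib

/-!
# Route `ResidualThetaTransportAtTwo`: the K0⁺ twin `HeckeThetaPartnerAdicAtTwoOfRibet` HOLDS

The route pen's «K0⁺ antecedent repair» (director-bsd W-60 (1), stage-k0r): the published input of the 2-adic Hecke theta
partner K0⁺ `HeckeThetaPartnerAdicAtTwo` (stmt-BirchSwinnertonDyer-20690) — Ribet's 1977 theorem that the theta series of a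
Grössencharakter of type (1,0) of an imaginary quadratic field is a CM newform on Γ₀ (the Literature fact
`Ribet1977_cmNewform_gamma0_of_isGrossencharakter`, cite-only) — became the PUB binder `RibetCMNewformGammaZeroSupply` of the
route's `closes`, and K0⁺ itself the proved twin `HeckeThetaPartnerAdicAtTwoOfRibet := <Ribet fact> → HeckeThetaPartnerAdicAtTwo`.
The twin is closed by lead rtt-p1's landed theorem `heckeThetaPartnerAdicAtTwo_of_ribet` (p583175,
`Theorems/ResidualThetaTransportAtTwoHeckeThetaPartnerAdicAtTwo.lean`), whose module imports the route file and therefore cannot be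
called from the route's glue — hence this one-line closer. THEOREM ONLY; nothing else is asserted; BSD is not proved by this.
-/

set_option autoImplicit false
-- the Theorems namespace of this sub repeats the summit name by design (D-0017 nested layout)
set_option linter.dupNamespace false

namespace Summit.BirchSwinnertonDyer.BirchSwinnertonDyer.Theorems

/-- **`HeckeThetaPartnerAdicAtTwoOfRibet` holds**: granted Ribet's theorem (theta series of type-(1,0) Grössencharaktere of an
imaginary quadratic field are CM newforms on `Γ₀(|d_K|·N𝔣)`), every habitat⁺ curve `W` has a 2-adic Hecke theta partner — an odd
level `M`, a CM newform `g` on `Γ₀(M)` of weight 2 with `a₂(g) = 0`, an embedding `ι` of its coefficient field into `ℚ̄₂`, a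
cohomological plus period, and `‖ι a_ℓ(g) − a_ℓ(W)‖ < 1` for all primes `ℓ ∤ 2·M·N_W` — by lead rtt-p1's
`heckeThetaPartnerAdicAtTwo_of_ribet`. [cite: Ribet1977, Thm. (CM newforms from Grössencharaktere)] [cite: Shimura1971ZetaCM, §1]
[cite: PollackWeston2011MT, §2.4 (cohomological periods)] -/
theorem heckeThetaPartnerAdicAtTwoOfRibet_proof :
    Summit.BirchSwinnertonDyer.BirchSwinnertonDyer.Theses.ResidualThetaTransportAtTwo.HeckeThetaPartnerAdicAtTwoOfRibet :=
  heckeThetaPartnerAdicAtTwo_of_ribet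

end Summit.BirchSwinnertonDyer.BirchSwinnertonDyer.Theorems
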